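import Summits.AtomisticToContinuum.BoseEinsteinCondensation.Theorems.BECConjugateDominationPuffFloorInnerPairCountCounting

/-!
# Route `BECConjugateDomination`, crux `PuffFloor` (stmt-AtomisticToContinuum-11785),
# line `coupling-slope-pocket`, stub S7in `stub_innerPairCount` — the glue

Supports (does not close) stmt-AtomisticToContinuum-11785. `innerPairCount_of`: the registered statement of the
lead's glue stub S7in of skeleton v6, proved from the registered statements of S7a (`stub_weakPairSubsolution`), S7c
(`stub_smearedPairDensityLaplacian`) and S7d (`stub_maxPrinciple`) taken as hypotheses (the one-line discharge
`stub_innerPairCount` is landed separately once the three stubs are in the tree).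

Mechanism (no clustering INSIDE the barrier of a coreless potential, for the EXACT minimiser): `r_*` an interior
maximum point of the profile (`exists_barrier`), `k` the periodised flat-top bump of radius `δ₀`
(`exists_flatTop_profile`, `kernel_*`), `G(y) = E_Ψ[k(x₀ − x₁ − y)]` the smeared pair density. By S7c and S7a
(test function `k(· − y)`), `ΔG + λ₁G ≥ 0` on `ℝ³` (`λ₁ = 1/r_*²`, removal energy `≤ λ₁`); on the sphere
`|y| = r_*` the kernel only sees the band where `v^per ≥ v_max/2`, so `G ≤ (2/v_max)·E_Ψ[v^per(x₀−x₁)]`; S7d carries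
the bound into the ball; a finite `δ₀/2`-net of `B̄(0, r_*/2)` dominates the periodised indicator `1^per_{≤ r_*/2}`
by the kernels centred on the net (flat top), and Bose symmetry turns the `(0,1)` bounds into
`E_Ψ #{i<j : |xᵢ−xⱼ|_T ≤ r_*/2} ≤ #net · C_mp · (2/v_max) · ⟨Ψ, H(v)Ψ⟩` (`lintegral_pairIndicator_le`).

References: Protter–Weinberger, *Maximum Principles in Differential Equations* (1967), Ch. 2 Thm 10; LSSY2005 Ch. 2.
-/

noncomputable section

namespace Summit.AtomisticToContinuum.BoseEinsteinCondensation.Theorems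

open MeasureTheory Filter Metric
open scoped ENNReal NNReal BigOperators Laplacian Topology
open Literature.MathematicalPhysics.QuantumManyBody.BoseGas

namespace PuffFloorInnerPairCount

/-- **Inner pair count from the analytic stubs** (the glue of S7in): the registered statement of
`stub_innerPairCount`, proved from the registered statements of S7a (`stub_weakPairSubsolution`), S7c
(`stub_smearedPairDensityLaplacian`) and S7d (`stub_maxPrinciple`) taken as hypotheses. See the module docstring
for the mechanism. (maximum principle: Protter–Weinberger 1967, Ch. 2; Gilbarg–Trudinger 2001, Cor. 3.2). [folklore] -/
theorem innerPairCount_of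
    (hWPS : ∀ v : ℝ → ℝ≥0∞, IsRepulsiveFiniteRange v → (∀ r, v r ≠ ⊤) →
      ContDiff ℝ 2 (fun x : Space => (v ‖x‖).toReal) →
      ∀ R₀ : ℝ, 0 < R₀ → (∀ r, R₀ < r → v r = 0) →
      ∀ (n : ℕ) (L : ℝ), 0 < L → 2 * R₀ < L → ∀ Ψ : PeriodicTrialState (n + 2) L,
        periodicEnergy v Ψ = periodicGroundStateEnergy v (n + 2) L → periodicEnergy v Ψ ≠ ⊤ →
        ContDiff ℝ 3 Ψ.ψ → (∀ X, Ψ.ψ X = (‖Ψ.ψ X‖ : ℂ)) →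
        ∀ f : Space → ℝ, ContDiff ℝ 2 f → (∀ z, 0 ≤ f z) →
          (∀ (z : Space) (q : Fin 3 → ℤ), f (z + latticeVec L q) = f z) →
          0 ≤ ∫ X in cellN (n + 2) L,
              ((Δ f) (X 0 - X 1) +
                ((periodicGroundStateEnergy v (n + 2) L).toReal -
                  (periodicGroundStateEnergy v n L).toReal) * f (X 0 - X 1)) * ‖Ψ.ψ X‖ ^ 2)
    (hSPD : ∀ (n : ℕ) (L : ℝ), 0 < L → ∀ (Ψ : PeriodicTrialState (n + 2) L) (k : Space → ℝ) (B : ℝ),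
      ContDiff ℝ 2 k → (∀ z, |k z| ≤ B) → (∀ z, ‖fderiv ℝ k z‖ ≤ B) →
      (∀ z, ‖iteratedFDeriv ℝ 2 k z‖ ≤ B) →
      ContDiff ℝ 2 (fun y : Space => ∫ X in cellN (n + 2) L, k (X 0 - X 1 - y) * ‖Ψ.ψ X‖ ^ 2) ∧
      ∀ y : Space,
        (Δ (fun y' : Space => ∫ X in cellN (n + 2) L, k (X 0 - X 1 - y') * ‖Ψ.ψ X‖ ^ 2)) y =
          ∫ X in cellN (n + 2) L, (Δ k) (X 0 - X 1 - y) * ‖Ψ.ψ X‖ ^ 2)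
    (hMP : ∃ Cmp : ℝ, 0 < Cmp ∧ ∀ (u : Space → ℝ) (x₀ : Space) (R lam B : ℝ),
      0 < R → 0 ≤ lam → lam * R ^ 2 ≤ 1 → 0 ≤ B → ContDiff ℝ 2 u →
      (∀ x ∈ Metric.ball x₀ R, 0 ≤ (Δ u) x + lam * u x) →
      (∀ x ∈ Metric.sphere x₀ R, u x ≤ B) →
      ∀ x ∈ Metric.closedBall x₀ R, u x ≤ Cmp * B) :
    ∀ v : ℝ → ℝ≥0∞, IsRepulsiveFiniteRange v → (∀ r, v r ≠ ⊤) →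
      ContDiff ℝ 2 (fun x : Space => (v ‖x‖).toReal) →
      v 0 = 0 → (∃ r, 0 < r ∧ 0 < v r) →
      ∃ rin Cin L₁ lam₁ : ℝ, 0 < rin ∧ 0 ≤ Cin ∧ 0 < L₁ ∧ 0 < lam₁ ∧
        ∀ (n : ℕ) (L : ℝ), L₁ ≤ L → ∀ Ψ : PeriodicTrialState (n + 2) L,
          periodicEnergy v Ψ = periodicGroundStateEnergy v (n + 2) L → periodicEnergy v Ψ ≠ ⊤ →
          ContDiff ℝ 3 Ψ.ψ → (∀ X, Ψ.ψ X = (‖Ψ.ψ X‖ : ℂ)) →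
          (periodicGroundStateEnergy v (n + 2) L).toReal - (periodicGroundStateEnergy v n L).toReal ≤ lam₁ →
          (∫⁻ X in cellN (n + 2) L,
              periodicInteraction (Set.indicator (Set.Iic rin) (fun _ : ℝ => (1 : ℝ≥0∞))) L X *
                (‖Ψ.ψ X‖₊ : ℝ≥0∞) ^ 2)
            ≤ ENNReal.ofReal Cin * periodicEnergy v Ψ := by
  intro v hv hfin hC2 h0 hpos
  -- constants from the profile
  obtain ⟨R₀, hR₀, hrange⟩ : ∃ R₀ : ℝ, 0 < R₀ ∧ ∀ r, R₀ < r → v r = 0 := by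
    obtain ⟨R, hR⟩ := hv.2
    exact ⟨max R 1, lt_max_of_lt_right one_pos, fun r hr => hR r (lt_of_le_of_lt (le_max_left R 1) hr)⟩
  obtain ⟨rs, vmax, δ₀, hrs, hvmax, hδ₀, hδrs, hrsR, hvle, hband⟩ :=
    exists_barrier v hfin hC2 h0 hpos hR₀ hrange
  obtain ⟨hb, hhb, hb0, hb1, hbflat, hbsupp⟩ := exists_flatTop_profile hδ₀
  obtain ⟨Cmp, hCmp, hmp⟩ := hMP
  -- a finite `δ₀/2`-net of the closed ball of radius `rin = rs/2`
  obtain ⟨T, hTsub, hTfin, hTcov⟩ :=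
    finite_cover_balls_of_compact (isCompact_closedBall (0 : Space) (rs / 2)) (half_pos hδ₀)
  set Tf := hTfin.toFinset with hTf
  refine ⟨rs / 2, (Tf.card : ℝ) * (Cmp * (2 / vmax)), 2 * R₀ + 2 * rs + 1, 1 / rs ^ 2, by positivity,
    by positivity, by positivity, by positivity, ?_⟩
  intro n L hL₁ Ψ hmin hfinE hC3 hreal hrem
  have hL : 0 < L := by linarith
  have h2R : 2 * R₀ < L := by linarith
  have hδL : 2 * δ₀ < L := by linarith
  have h2rin : 2 * (rs / 2) < L := by linarith
  set ψ := Ψ.ψ with hψdef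
  have hψc : Continuous ψ := Ψ.contDiff.continuous
  -- the kernel
  set w : ℝ → ℝ≥0∞ := fun r => ENNReal.ofReal (hb r) with hw
  set kfun : Space → ℝ := fun z => (periodizedPotential w L z).toReal with hkfun
  have hk2 : ContDiff ℝ 2 kfun := kernel_contDiff hL hδL hhb hb0 hbsupp
  have hkc : Continuous kfun := hk2.continuous
  have hk_le : ∀ z, kfun z ≤ 1 := kernel_le_one hL hδL hb1 hbsupp
  have hk_nn : ∀ z, 0 ≤ kfun z := fun z => kernel_nonneg L hb z
  have hwp_top : ∀ z, periodizedPotential w L z ≠ ⊤ := fun z =>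
    ne_top_of_le_ne_top ENNReal.one_ne_top (periodizedProfile_le_one hL hδL hb1 hbsupp z)
  have hwpm : Measurable (periodizedPotential w L) := by
    have : periodizedPotential w L = fun z => ENNReal.ofReal (kfun z) :=
      funext fun z => (ENNReal.ofReal_toReal (hwp_top z)).symm
    rw [this]
    exact ENNReal.measurable_ofReal.comp hkc.measurable
  have hvpm : Measurable (periodizedPotential v L) := measurable_periodizedPotential hv.1 L
  obtain ⟨B, hkB, hDkB, hD2kB⟩ := kernel_bounds hL hδL hhb hb0 hb1 hbsupp
  -- the smeared pair density `G`
  set G : Space → ℝ := fun y => ∫ X in cellN (n + 2) L, kfun (X 0 - X 1 - y) * ‖ψ X‖ ^ 2 with hG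
  have hGfacts := hSPD n L hL Ψ kfun B hk2 hkB hDkB hD2kB
  have hG2 : ContDiff ℝ 2 G := hGfacts.1
  have hΔG : ∀ y, (Δ G) y = ∫ X in cellN (n + 2) L, (Δ kfun) (X 0 - X 1 - y) * ‖ψ X‖ ^ 2 := hGfacts.2
  have hG0 : ∀ y, 0 ≤ G y := fun y => integral_nonneg fun X => mul_nonneg (hk_nn _) (sq_nonneg _)
  have hΔkc : Continuous (Δ kfun) := by
    rw [InnerProductSpace.laplacian_eq_iteratedFDeriv_orthonormalBasis kfun (EuclideanSpace.basisFun (Fin 3) ℝ)]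
    exact continuous_finsetSum _ fun a _ =>
      (continuous_eval_const _).comp (hk2.continuous_iteratedFDeriv le_rfl)
  have hdiffc : Continuous fun X : Config (n + 2) => X 0 - X 1 := (continuous_apply 0).sub (continuous_apply 1)
  -- `G` is a subsolution of `Δ + λ₁` on all of `ℝ³`
  have hsub : ∀ y : Space, 0 ≤ (Δ G) y + 1 / rs ^ 2 * G y := by
    intro y
    have hf2 : ContDiff ℝ 2 (fun z : Space => kfun (z - y)) := hk2.comp (contDiff_id.sub contDiff_const)
    have hf0 : ∀ z, 0 ≤ kfun (z - y) := fun z => hk_nn _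
    have hfper : ∀ (z : Space) (q : Fin 3 → ℤ), kfun (z + latticeVec L q - y) = kfun (z - y) := fun z q => by
      rw [add_sub_right_comm]
      exact kernel_periodic L hb (z - y) q
    have h := hWPS v hv hfin hC2 R₀ hR₀ hrange n L hL h2R Ψ hmin hfinE hC3 hreal (fun z => kfun (z - y))
      hf2 hf0 hfper
    simp only [← hψdef] at h
    have hlap : ∀ X : Config (n + 2), (Δ fun z => kfun (z - y)) (X 0 - X 1) = (Δ kfun) (X 0 - X 1 - y) :=
      fun X => laplacian_comp_sub kfun y _
    simp_rw [hlap] at h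
    have hi1 : IntegrableOn (fun X : Config (n + 2) => (Δ kfun) (X 0 - X 1 - y) * ‖ψ X‖ ^ 2)
        (cellN (n + 2) L) volume :=
      integrableOn_cellN ((hΔkc.comp (hdiffc.sub continuous_const)).mul (hψc.norm.pow 2)) L
    have hi2 : IntegrableOn (fun X : Config (n + 2) => kfun (X 0 - X 1 - y) * ‖ψ X‖ ^ 2) (cellN (n + 2) L) volume :=
      integrableOn_cellN ((hkc.comp (hdiffc.sub continuous_const)).mul (hψc.norm.pow 2)) L
    set μ₂ := (periodicGroundStateEnergy v (n + 2) L).toReal - (periodicGroundStateEnergy v n L).toReal with hμ₂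
    have hpt : ∀ X : Config (n + 2), ((Δ kfun) (X 0 - X 1 - y) + μ₂ * kfun (X 0 - X 1 - y)) * ‖ψ X‖ ^ 2 =
        (Δ kfun) (X 0 - X 1 - y) * ‖ψ X‖ ^ 2 + μ₂ * (kfun (X 0 - X 1 - y) * ‖ψ X‖ ^ 2) := fun X => by ring
    simp_rw [hpt] at h
    rw [integral_add hi1 (hi2.const_mul μ₂), integral_const_mul, ← hΔG y] at h
    have hGy : ∫ X in cellN (n + 2) L, kfun (X 0 - X 1 - y) * ‖ψ X‖ ^ 2 = G y := rfl
    rw [hGy] at h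
    nlinarith [hG0 y, mul_le_mul_of_nonneg_right hrem (hG0 y)]
  -- the pair potential energy density and the sphere bound
  set Iv : ℝ := ∫ X in cellN (n + 2) L, (periodizedPotential v L (X 0 - X 1)).toReal * ‖ψ X‖ ^ 2 with hIv
  have hIv0 : 0 ≤ Iv := integral_nonneg fun X => mul_nonneg ENNReal.toReal_nonneg (sq_nonneg _)
  have hvp_top : ∀ z, periodizedPotential v L z ≠ ⊤ := fun z => periodizedPotential_ne_top_of_range hrange h2R hL hfin z
  have hvpc : Continuous fun z : Space => (periodizedPotential v L z).toReal :=
    (contDiff_toReal_periodizedPotential hrange h2R hL hC2).continuous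
  have hpt_sphere : ∀ y : Space, ‖y‖ = rs → ∀ z : Space,
      kfun (z - y) ≤ 2 / vmax * (periodizedPotential v L z).toReal := by
    intro y hy z
    by_cases hk0 : kfun (z - y) = 0
    · rw [hk0]; positivity
    · obtain ⟨q, hq⟩ := kernel_support hbsupp hk0
      have hb' : |‖z - latticeVec L q‖ - rs| < δ₀ := by
        rw [← hy]
        exact (abs_norm_sub_norm_le _ _).trans_lt hq
      have h1 : vmax / 2 ≤ (v ‖z - latticeVec L q‖).toReal := hband _ hb'
      have h2 : (v ‖z - latticeVec L q‖).toReal ≤ (periodizedPotential v L z).toReal :=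
        ENNReal.toReal_mono (hvp_top z) (ENNReal.le_tsum (f := fun q => v ‖z - latticeVec L q‖) q)
      calc kfun (z - y) ≤ 1 := hk_le _
        _ = 2 / vmax * (vmax / 2) := by field_simp
        _ ≤ 2 / vmax * (periodizedPotential v L z).toReal := by gcongr; exact h1.trans h2
  have hsphere : ∀ y ∈ Metric.sphere (0 : Space) rs, G y ≤ 2 / vmax * Iv := by
    intro y hy
    rw [mem_sphere_zero_iff_norm] at hy
    have hi2 : IntegrableOn (fun X : Config (n + 2) => kfun (X 0 - X 1 - y) * ‖ψ X‖ ^ 2) (cellN (n + 2) L) volume :=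
      integrableOn_cellN ((hkc.comp (hdiffc.sub continuous_const)).mul (hψc.norm.pow 2)) L
    have hi3 : IntegrableOn (fun X : Config (n + 2) =>
        2 / vmax * ((periodizedPotential v L (X 0 - X 1)).toReal * ‖ψ X‖ ^ 2)) (cellN (n + 2) L) volume :=
      (integrableOn_cellN ((hvpc.comp hdiffc).mul (hψc.norm.pow 2)) L).const_mul _
    calc G y = ∫ X in cellN (n + 2) L, kfun (X 0 - X 1 - y) * ‖ψ X‖ ^ 2 := rfl
      _ ≤ ∫ X in cellN (n + 2) L, 2 / vmax * ((periodizedPotential v L (X 0 - X 1)).toReal * ‖ψ X‖ ^ 2) := by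
          refine integral_mono hi2 hi3 fun X => ?_
          have := mul_le_mul_of_nonneg_right (hpt_sphere y hy (X 0 - X 1)) (sq_nonneg ‖ψ X‖)
          simpa only [mul_assoc] using this
      _ = 2 / vmax * Iv := integral_const_mul _ _
  -- the maximum principle on the closed ball of radius `rs`
  have hball : ∀ y ∈ Metric.closedBall (0 : Space) rs, G y ≤ Cmp * (2 / vmax * Iv) :=
    hmp G 0 rs (1 / rs ^ 2) (2 / vmax * Iv) hrs (by positivity) (le_of_eq (by field_simp)) (by positivity) hG2
      (fun x _ => hsub x) hsphere
  -- the cover: the periodised indicator is dominated by the kernels centred on the net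
  set ind : ℝ → ℝ≥0∞ := Set.indicator (Set.Iic (rs / 2)) (fun _ : ℝ => (1 : ℝ≥0∞)) with hind
  have hindR : ∀ r, rs / 2 < r → ind r = 0 := fun r hr =>
    Set.indicator_of_notMem (by simpa using hr) _
  have hcover : ∀ z : Space, periodizedPotential ind L z ≤ ∑ t ∈ Tf, periodizedPotential w L (z - t) := by
    intro z
    rcases periodizedPotential_eq_zero_or_exists hindR h2rin hL z with hz | ⟨q, hq, hzq⟩
    · rw [hz]; exact bot_le
    · have hu : z - latticeVec L q ∈ Metric.closedBall (0 : Space) (rs / 2) := by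
        rwa [mem_closedBall_zero_iff]
      obtain ⟨t, ht, htu⟩ := Set.mem_iUnion₂.1 (hTcov hu)
      have htf : t ∈ Tf := hTfin.mem_toFinset.2 ht
      have hle1 : periodizedPotential ind L z ≤ 1 := by
        rw [hzq]
        exact Set.indicator_apply_le' (fun _ => le_rfl) (fun _ => zero_le_one)
      have hge1 : 1 ≤ periodizedPotential w L (z - t) :=
        periodizedProfile_flatTop hbflat (q := q) (by rw [mem_ball_iff_norm] at htu; exact htu.le)
      exact hle1.trans (hge1.trans (Finset.single_le_sum (f := fun t => periodizedPotential w L (z - t))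
        (fun _ _ => bot_le) htf))
  -- the pair bound at each centre of the net
  have hpair : ∀ t ∈ Tf, ∫⁻ X in cellN (n + 2) L, periodizedPotential w L (X 0 - X 1 - t) * (‖ψ X‖₊ : ℝ≥0∞) ^ 2 ≤
      ENNReal.ofReal (Cmp * (2 / vmax)) *
        ∫⁻ X in cellN (n + 2) L, periodizedPotential v L (X 0 - X 1) * (‖ψ X‖₊ : ℝ≥0∞) ^ 2 := by
    intro t ht
    have ht' : t ∈ Metric.closedBall (0 : Space) rs := by
      have h := hTsub (hTfin.mem_toFinset.1 ht)
      rw [mem_closedBall_zero_iff] at h ⊢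
      linarith
    have hGt := hball t ht'
    have hL1 : ∫⁻ X in cellN (n + 2) L, periodizedPotential w L (X 0 - X 1 - t) * (‖ψ X‖₊ : ℝ≥0∞) ^ 2 =
        ENNReal.ofReal (G t) :=
      lintegral_weight_eq_ofReal (F := fun X : Config (n + 2) => periodizedPotential w L (X 0 - X 1 - t)) hψc
        (fun X => hwp_top _) (hkc.comp (hdiffc.sub continuous_const))
    have hL2 : ∫⁻ X in cellN (n + 2) L, periodizedPotential v L (X 0 - X 1) * (‖ψ X‖₊ : ℝ≥0∞) ^ 2 =
        ENNReal.ofReal Iv :=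
      lintegral_weight_eq_ofReal (F := fun X : Config (n + 2) => periodizedPotential v L (X 0 - X 1)) hψc
        (fun X => hvp_top _) (hvpc.comp hdiffc)
    rw [hL1, hL2, ← ENNReal.ofReal_mul (by positivity)]
    exact ENNReal.ofReal_le_ofReal (hGt.trans_eq (by ring))
  -- conclude by the abstract counting step
  have hcount := lintegral_pairIndicator_le Ψ (ind := ind) hvpm hwpm Tf (ENNReal.ofReal (Cmp * (2 / vmax)))
    hcover hpair
  refine hcount.trans (le_of_eq ?_)
  rw [ENNReal.ofReal_mul (Nat.cast_nonneg _), ENNReal.ofReal_natCast]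

end PuffFloorInnerPairCount

open PuffFloorInnerPairCount in
/-- **Registered helper `puffFloor_innerPairCount_of`** (sub-goal of stmt-AtomisticToContinuum-11785 for the glue of stub
S7in): the registered statement of S7in from the registered statements of S7a, S7c, S7d —
`PuffFloorInnerPairCount.innerPairCount_of`. -/
theorem puffFloor_innerPairCount_of :
    (∀ v : ℝ → ℝ≥0∞, IsRepulsiveFiniteRange v → (∀ r, v r ≠ ⊤) →
      ContDiff ℝ 2 (fun x : Space => (v ‖x‖).toReal) →
      ∀ R₀ : ℝ, 0 < R₀ → (∀ r, R₀ < r → v r = 0) →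
      ∀ (n : ℕ) (L : ℝ), 0 < L → 2 * R₀ < L → ∀ Ψ : PeriodicTrialState (n + 2) L,
        periodicEnergy v Ψ = periodicGroundStateEnergy v (n + 2) L → periodicEnergy v Ψ ≠ ⊤ →
        ContDiff ℝ 3 Ψ.ψ → (∀ X, Ψ.ψ X = (‖Ψ.ψ X‖ : ℂ)) →
        ∀ f : Space → ℝ, ContDiff ℝ 2 f → (∀ z, 0 ≤ f z) →
          (∀ (z : Space) (q : Fin 3 → ℤ), f (z + latticeVec L q) = f z) →
          0 ≤ ∫ X in cellN (n + 2) L,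
              ((Δ f) (X 0 - X 1) +
                ((periodicGroundStateEnergy v (n + 2) L).toReal -
                  (periodicGroundStateEnergy v n L).toReal) * f (X 0 - X 1)) * ‖Ψ.ψ X‖ ^ 2) →
    (∀ (n : ℕ) (L : ℝ), 0 < L → ∀ (Ψ : PeriodicTrialState (n + 2) L) (k : Space → ℝ) (B : ℝ),
      ContDiff ℝ 2 k → (∀ z, |k z| ≤ B) → (∀ z, ‖fderiv ℝ k z‖ ≤ B) →
      (∀ z, ‖iteratedFDeriv ℝ 2 k z‖ ≤ B) →
      ContDiff ℝ 2 (fun y : Space => ∫ X in cellN (n + 2) L, k (X 0 - X 1 - y) * ‖Ψ.ψ X‖ ^ 2) ∧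
      ∀ y : Space,
        (Δ (fun y' : Space => ∫ X in cellN (n + 2) L, k (X 0 - X 1 - y') * ‖Ψ.ψ X‖ ^ 2)) y =
          ∫ X in cellN (n + 2) L, (Δ k) (X 0 - X 1 - y) * ‖Ψ.ψ X‖ ^ 2) →
    (∃ Cmp : ℝ, 0 < Cmp ∧ ∀ (u : Space → ℝ) (x₀ : Space) (R lam B : ℝ),
      0 < R → 0 ≤ lam → lam * R ^ 2 ≤ 1 → 0 ≤ B → ContDiff ℝ 2 u →
      (∀ x ∈ Metric.ball x₀ R, 0 ≤ (Δ u) x + lam * u x) →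
      (∀ x ∈ Metric.sphere x₀ R, u x ≤ B) →
      ∀ x ∈ Metric.closedBall x₀ R, u x ≤ Cmp * B) →
    ∀ v : ℝ → ℝ≥0∞, IsRepulsiveFiniteRange v → (∀ r, v r ≠ ⊤) →
      ContDiff ℝ 2 (fun x : Space => (v ‖x‖).toReal) →
      v 0 = 0 → (∃ r, 0 < r ∧ 0 < v r) →
      ∃ rin Cin L₁ lam₁ : ℝ, 0 < rin ∧ 0 ≤ Cin ∧ 0 < L₁ ∧ 0 < lam₁ ∧
        ∀ (n : ℕ) (L : ℝ), L₁ ≤ L → ∀ Ψ : PeriodicTrialState (n + 2) L,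
          periodicEnergy v Ψ = periodicGroundStateEnergy v (n + 2) L → periodicEnergy v Ψ ≠ ⊤ →
          ContDiff ℝ 3 Ψ.ψ → (∀ X, Ψ.ψ X = (‖Ψ.ψ X‖ : ℂ)) →
          (periodicGroundStateEnergy v (n + 2) L).toReal - (periodicGroundStateEnergy v n L).toReal ≤ lam₁ →
          (∫⁻ X in cellN (n + 2) L,
              periodicInteraction (Set.indicator (Set.Iic rin) (fun _ : ℝ => (1 : ℝ≥0∞))) L X *
                (‖Ψ.ψ X‖₊ : ℝ≥0∞) ^ 2)
            ≤ ENNReal.ofReal Cin * periodicEnergy v Ψ :=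
  innerPairCount_of

end Summit.AtomisticToContinuum.BoseEinsteinCondensation.Theorems

end
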